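import Summits.NavierStokesRegularity.OSWSelfSimilar.SheetRLinearisedSemigroup
import Summits.NavierStokesRegularity.OSWSelfSimilar.SheetREvansOdd
import Literature.Analysis.UnboundedOperators.HilleYosidaPerturbation
import HarnessLib

/-!
# SHEET-ℝ frame, Z3-SR-SPEC (P9) for the FULL linearisation: `−DG(Ω*)|odd = T + θℓ(·)f` GENERATES a C₀-semigroup on `L²_{w,odd}(ℂ)`
# (bounded rank-one perturbation of the coercive part), and weak eigenvectors evolve as `e^{στ}`

HONEST FRAMING (cell ns-blowup GROUP B / zone Z3, case Z3-SR-SPEC, P-list item (P9) «C₀-semigroup generation» for the linearised MODEL profile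
map; 1-D MODEL certificate frame (viscous gCLM/OSW sheet on the line); not Euler/NS; «violates: none — MODEL»).  Nothing here asserts that a
profile or an eigenvalue exists; the Gårding datum ((S1), interval arithmetic) is the HYPOTHESIS `GardingDataKC`; `K`, `ℓ : Wcodd L →L[ℂ] ℂ`,
`f ∈ Wcodd L`, `θ ∈ ℂ` are ARBITRARY (dictionary of record, selfsim g12 HANDOFF: `K = −P* + F`, `T = generatorOdd = −A_F|odd`, and
`A_F − θℓ(·)f = DG(Ω*)`, so the linearised flow `δ' = −DG(Ω*)δ` on the odd class is generated by `T + θℓ(·)f`).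

`SheetRLinearisedSemigroup` gave the semigroup of the COERCIVE part `T` (`‖e^{τT}‖ ≤ e^{−mτ}`).  The rank-one gauge feedback
`F′u = θℓ(u)f` — the operator `(θ • ℓ).smulRight f`, `‖F′‖ = ‖θ‖‖ℓ‖‖f‖` — is bounded, so the generic BOUNDED PERTURBATION THEOREM
(`Literature/Analysis/UnboundedOperators/HilleYosidaPerturbation.lean`, Engel–Nagel III.1.3 via the perturbed pseudo-resolvent
`R_{F′}(σ) = R_K(σ)(1 − F′R_K(σ))⁻¹`) applies:

* **`exists_c0Semigroup_full`** — for `‖F′‖ ≤ b` and any base point `σ₀` with `Re σ₀ > b − m` there is a C₀-semigroup `S` on `Wcodd L` with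
  **`‖S(τ)‖ ≤ e^{(b − m)τ}`**, whose generator `B` has domain `D(T)` and acts as **`Bu = Tu + θℓ(u)f`** (`= −DG(Ω*)u` in the dictionary), and
  whose Laplace transform is the perturbed resolvent; hypotheses = the (S1) datum ONLY (density of `D(T)`: cert-5's `dense_domain_generatorOdd`);
* **`app_eq_exp_smul_of_isWeakEigen`** — a WEAK eigenvector `u` of `A − θℓ(·)f` at `σ` (selfsim g12's `IsWeakEigen`, i.e. `(T + F′)u = σu`)
  evolves under ANY C₀-semigroup with that generator as `S(τ)u = e^{στ}u`; in particular the certified gauge mode (`σ = 1`, cert-5 (P6)) grows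
  like `e^{τ}` and every weak eigenvector with `Re σ < 0` decays — the dynamical reading of the S2 census `{weak eigenvalues, Re σ > −3/100} = {1}`.
No definition, no named fact.  WHAT THIS IS NOT: not NS; not (P10) — no splitting / growth bound on the spectral complement of the gauge mode is
claimed (that is the renewal step, cert-5 P9-P10-RENEWAL-DESIGN.md v2 (R-a)–(R-d)); no number of record moves.
-/

noncomputable section

namespace Summit.NavierStokesRegularity.OSWSelfSimilar
namespace SheetRLinearisedFlow

open _root_.MeasureTheory _root_.Set _root_.Filter SheetREnergySpace SheetRComplexPivot SheetRPerturbedResolventC SheetROddClass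
  SheetRResolventOddClass SheetRGeneratorOddWeak SheetREvansOdd SheetRLinearisedSemigroup Literature.Analysis.OperatorTheory
  Literature.Analysis.UnboundedOperators Literature.Analysis.UnboundedOperators.HilleYosida
open scoped Topology NNReal

variable {L D₀ D₁ V₀ c m : ℝ} {d V : ℝ → ℝ}

/-! ### §1 The rank-one feedback and the smallness of `F′R_K(σ)` -/

/-- The rank-one operator `u ↦ θℓ(u)f` acts as written. [folklore] -/
theorem rankOne_apply (ℓ : Wcodd L →L[ℂ] ℂ) (f : Wcodd L) (θ : ℂ) (u : Wcodd L) :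
    ((θ • ℓ).smulRight f) u = (θ * ℓ u) • f := by
  rw [ContinuousLinearMap.smulRight_apply, smul_apply, smul_eq_mul]

/-- `‖F′‖ ≤ ‖θ‖‖ℓ‖‖f‖` for the rank-one operator `F′ = θℓ(·)f` (the natural choice of `b` below). [folklore] -/
theorem norm_rankOne_le (ℓ : Wcodd L →L[ℂ] ℂ) (f : Wcodd L) (θ : ℂ) : ‖(θ • ℓ).smulRight f‖ ≤ ‖θ‖ * ‖ℓ‖ * ‖f‖ := by
  refine ContinuousLinearMap.opNorm_le_bound _ (by positivity) fun u => ?_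
  rw [rankOne_apply, norm_smul, norm_mul]
  calc ‖θ‖ * ‖ℓ u‖ * ‖f‖ ≤ ‖θ‖ * (‖ℓ‖ * ‖u‖) * ‖f‖ := by gcongr; exact ℓ.le_opNorm u
    _ = ‖θ‖ * ‖ℓ‖ * ‖f‖ * ‖u‖ := by ring

/-- Operator-norm form of the pivot bound: `‖R_K(σ)‖ ≤ 1/(m + Re σ)` on the odd class. [folklore] -/
theorem opNorm_resolventOdd_le (hL : 0 < L) (K : Esp L hL →L[ℝ] W L) (h : GardingDataKC L hL d V K D₀ D₁ V₀ c m) {σ : ℂ} (hσ : -m < σ.re) :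
    ‖resolventOdd hL K h σ‖ ≤ (m + σ.re)⁻¹ := by
  have hpos : 0 < m + σ.re := by linarith
  refine ContinuousLinearMap.opNorm_le_bound _ (inv_nonneg.2 hpos.le) fun G => ?_
  rw [inv_mul_eq_div]
  exact norm_resolventOdd_le_inv hL K h hσ G

/-- **Smallness**: for a bounded `F′` with `‖F′‖ ≤ b` and `Re σ > b − m`, `‖F′R_K(σ)‖ ≤ b/(m + Re σ) < 1`, so the perturbed resolvent
`R_K(σ)(1 − F′R_K(σ))⁻¹` is defined by its Neumann series. [folklore] -/
theorem norm_mul_resolventOdd_lt_one (hL : 0 < L) (K : Esp L hL →L[ℝ] W L) (h : GardingDataKC L hL d V K D₀ D₁ V₀ c m)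
    {F' : Wcodd L →L[ℂ] Wcodd L} {b : ℝ} (hF : ‖F'‖ ≤ b) {σ : ℂ} (hσ : b - m < σ.re) : ‖F' * resolventOdd hL K h σ‖ < 1 := by
  have hb : 0 ≤ b := (norm_nonneg F').trans hF
  have hσ' : -m < σ.re := by linarith
  have hpos : 0 < m + σ.re := by linarith
  calc ‖F' * resolventOdd hL K h σ‖ ≤ ‖F'‖ * ‖resolventOdd hL K h σ‖ := ContinuousLinearMap.opNorm_comp_le F' _
    _ ≤ b * (m + σ.re)⁻¹ := mul_le_mul hF (opNorm_resolventOdd_le hL K h hσ') (norm_nonneg (resolventOdd hL K h σ)) hb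
    _ < 1 := by rw [← div_eq_mul_inv, div_lt_one hpos]; linarith

/-! ### §2 (P9) for the full linearisation `T + θℓ(·)f` -/

/-- **Z3-SR-SPEC (P9), FULL LINEARISATION — `−DG(Ω*)|odd = T + θℓ(·)f` GENERATES A C₀-SEMIGROUP (modulo the (S1) datum only).**  For a
Gårding datum `h` (the (S1) sentence), rank-one data `(ℓ, f, θ)` with `‖(θ•ℓ).smulRight f‖ ≤ b`, and a base point `σ₀` with `Re σ₀ > b − m`:
there is a C₀-semigroup `S` on `Wcodd L` with `‖S(τ)‖ ≤ e^{(b − m)τ}`, whose Laplace transform on `{Re σ > b − m}` is the perturbed resolvent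
`R_K(σ)(1 − F′R_K(σ))⁻¹` (`F′ = θℓ(·)f`), whose generator `B` has EXACTLY the domain of `T = generatorOdd hL K h σ₀ _`, and which acts there as
`Bu = Tu + θℓ(u)f`.  Engel–Nagel III.1.3 (`M = 1`) for the injective pseudo-resolvent `resolventOdd` with its pivot bound; density of `D(T)` by
cert-5's `dense_domain_generatorOdd`.  1-D MODEL, conditional on (S1) through `h`; NOT Navier–Stokes.
[cite: EngelNagel2000, Ch. III Thm. 1.3] -/
theorem exists_c0Semigroup_full (hL : 0 < L) (K : Esp L hL →L[ℝ] W L) (h : GardingDataKC L hL d V K D₀ D₁ V₀ c m)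
    (ℓ : Wcodd L →L[ℂ] ℂ) (f : Wcodd L) (θ : ℂ) {b : ℝ} (hF : ‖(θ • ℓ).smulRight f‖ ≤ b) {σ₀ : ℂ} (hσ₀ : b - m < σ₀.re) :
    ∃ hσ₀' : -m < σ₀.re, ∃ S : C0Semigroup ℂ (Wcodd L),
      (∀ τ : ℝ≥0, ‖S.app τ‖ ≤ Real.exp ((b - m) * τ)) ∧
      (∀ σ : ℂ, b - m < σ.re → ∀ G : Wcodd L,
        S.laplaceResolventFun σ G =
          @perturb (Wcodd L) _ _ (completeSpace_Wcodd L) (resolventOdd hL K h) ((θ • ℓ).smulRight f) σ G) ∧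
      ((S.generator.domain : Set (Wcodd L)) = (generatorOdd hL K h σ₀ hσ₀').domain) ∧
      (∀ (u : Wcodd L) (hu : u ∈ (generatorOdd hL K h σ₀ hσ₀').domain), ∃ hu' : u ∈ S.generator.domain,
        S.generator ⟨u, hu'⟩ = generatorOdd hL K h σ₀ hσ₀' ⟨u, hu⟩ + (θ * ℓ u) • f) := by
  haveI : CompleteSpace (Wcodd L) := completeSpace_Wcodd L
  have hb : 0 ≤ b := (norm_nonneg ((θ • ℓ).smulRight f)).trans hF
  have hσ₀' : -m < σ₀.re := by linarith
  refine ⟨hσ₀', ?_⟩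
  set F' : Wcodd L →L[ℂ] Wcodd L := (θ • ℓ).smulRight f with hF'
  have hsmall : ‖F' * resolventOdd hL K h σ₀‖ < 1 := norm_mul_resolventOdd_lt_one hL K h hF hσ₀
  have hdense : Dense (Set.range (resolventOdd hL K h σ₀)) := by
    have hd := SheetRGeneratorOddDense.dense_domain_generatorOdd hL K h hσ₀'
    rw [generatorOdd_domain] at hd
    simpa only [LinearMap.coe_range, ContinuousLinearMap.coe_coe] using hd
  obtain ⟨hinj, S, hS, hlap, hgen⟩ := HilleYosida.exists_c0Semigroup_perturb (K := F') (isPseudoResolvent_resolventOdd hL K h)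
    (m := m) (b := b) (fun l hl => ofReal_mem_halfPlane hl) (fun l hl => norm_resolventOdd_le hL K h hl) hF
    (z₀ := σ₀) hσ₀' (by linarith) hsmall hdense
  refine ⟨S, fun τ => ?_, fun σ hσ G => hlap σ (by show -m < σ.re; linarith) (by linarith)
    (norm_mul_resolventOdd_lt_one hL K h hF hσ) G, ?_, fun u hu => ?_⟩
  · have := hS τ; rwa [neg_sub] at this
  · rw [hgen]
    exact operatorOfResolvent_perturb_domain hsmall (injective_resolventOdd hL K h hσ₀')
  · obtain ⟨hu', happ⟩ := operatorOfResolvent_perturb_apply hsmall (injective_resolventOdd hL K h hσ₀') (u := u) hu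
    have hu'' : u ∈ S.generator.domain := by rw [hgen]; exact hu'
    refine ⟨hu'', ?_⟩
    have hgraph : ((u : Wcodd L), S.generator ⟨u, hu''⟩) ∈
        (operatorOfResolvent (perturb (resolventOdd hL K h) F') σ₀ hinj).graph := by
      rw [← hgen]; exact S.generator.mem_graph ⟨u, hu''⟩
    have heq := ((operatorOfResolvent (perturb (resolventOdd hL K h) F') σ₀ hinj).mem_graph_snd_inj
      (LinearPMap.mem_graph _ ⟨u, hu'⟩) hgraph rfl).symm
    rw [heq, happ, rankOne_apply]
    rfl

/-! ### §3 Weak eigenvectors evolve exponentially -/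

/-- **`S(τ)u = e^{στ}u` for a weak eigenvector.**  Let `S` be any C₀-semigroup on the odd class whose generator has the domain of `T` and acts as
`Tu + θℓ(u)f` there (e.g. the semigroup of `exists_c0Semigroup_full`).  If `u` is a WEAK eigenvector of `A − θℓ(·)f` at `σ`
(`IsWeakEigen hL K d V ℓ f θ σ u`: `Au = θℓ(u)f − σu` weakly, equivalently `(T + θℓ(·)f)u = σu`), then `S(τ)u = e^{στ}u` for all `τ ≥ 0`.
So the certified gauge mode (`σ = 1`) of the MODEL linearisation grows exactly like `e^{τ}`, and weak eigenvectors with `Re σ < 0` decay.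
[cite: EngelNagel2000, Ch. II Lemma 1.3] -/
theorem app_eq_exp_smul_of_isWeakEigen (hL : 0 < L) (K : Esp L hL →L[ℝ] W L) (h : GardingDataKC L hL d V K D₀ D₁ V₀ c m) {σ₀ : ℂ}
    (hσ₀ : -m < σ₀.re) (ℓ : Wcodd L →L[ℂ] ℂ) (f : Wcodd L) (θ : ℂ) (S : C0Semigroup ℂ (Wcodd L))
    (hgen : ∀ (u : Wcodd L) (hu : u ∈ (generatorOdd hL K h σ₀ hσ₀).domain), ∃ hu' : u ∈ S.generator.domain,
      S.generator ⟨u, hu'⟩ = generatorOdd hL K h σ₀ hσ₀ ⟨u, hu⟩ + (θ * ℓ u) • f)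
    {σ : ℂ} {u : Wcodd L} (hu : IsWeakEigen hL K d V ℓ f θ σ u) (τ : ℝ≥0) :
    S.app τ u = Complex.exp (σ * τ) • u := by
  haveI : CompleteSpace (Wcodd L) := completeSpace_Wcodd L
  obtain ⟨huT, hT⟩ := (isWeakEigen_iff_generator hL K h hσ₀ ℓ f θ σ u).1 hu
  obtain ⟨hu', hB⟩ := hgen u huT
  have heig : S.generator ⟨u, hu'⟩ = σ • u := by rw [hB, hT]; abel
  exact C0Semigroup.app_eq_exp_smul_of_generator_eq S ⟨u, hu'⟩ heig τ

end SheetRLinearisedFlow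
end Summit.NavierStokesRegularity.OSWSelfSimilar

end
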